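import Literature.NumberTheory.EllipticCurves.Kato2004.IwasawaCohomologyNumberFieldTwist
import Literature.NumberTheory.EllipticCurves.Kato2004.LocalIwasawaCohomologyMap
import HarnessLib

/-!
# `res ∘ cor + res^A ∘ cor^A = 2` on `𝐇¹_{K,Γ}(T_pW_K)` for a QUADRATIC twist `A = W^K`, and `loc_w̄ ∘ res^A = 𝐇¹(u_v) ∘ loc_v`
# (the two Shapiro-lattice clauses of the crux-19556 line: `2·L ≤ loc(𝐇¹_Γ(T_pW)) + u_A loc(𝐇¹_Γ(T_pA))`, `u_A loc(𝐇¹_Γ(T_pA)) ≤ L`)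

Topic `NumberTheory/EllipticCurves`, sub-directory `Kato2004`; eighth file of the `K`-carrier vocabulary.  Seat `bsd-2adic-conv-1`
GEN 30 (cell `pub/bsd-2adic`).  HONEST FRAMING: definitions with bodies and proved theorems only; no named fact, no `sorry`; nothing
about any curve is asserted; BSD is not advanced by this file.

With the data of `…Twist.lean` (`u : T_pA ≃ T_pW`, `galRange K`-equivariant) AND the sign hypothesis `hu₂ : u(σx) = −σu(x)` for
`σ ∉ galRange K` (the quadratic-twist isomorphism, `WeierstrassCurve.exists_tateModule_equiv_of_smul_eq_quadraticTwist`), `K/ℚ` Galois: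

* §1 **`layerResCor_add_layerResCorTwist`**: on `H¹(K_n, T_pW_K)`, `res_n (cor_n z) + res^A_n (cor^A_n z) = 2 z`.  Through the model: both
  `res ∘ cor` are `Σ_{x ∈ U_n/V_n} conj_{s x}` (normal-case double-coset formula) on `H¹(V_n, T_pW)` resp. `H¹(V_n, T_pA)`; moving the
  second through `u_*` flips the sign of the coset outside `galRange K` (`layerTwist_conjMap_of_not_mem`) and keeps the identity coset, whose
  representative acts trivially (`conjMap_one_apply_of_mem`): `(1 + σ) + (1 − σ) = 2`.  On the carriers:
  **`IwasawaH1DataOver.resOver_corOver_add_resOverTwist_corOverTwist`**: `res (cor x) + res^A (cor^A x) = 2 • x` in `𝐇¹_{K,Γ}(T_pW_K)`.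
* §2 the local side at a place `v` with `D_v ≤ galRange K` (`v` split in `K`): the `Γ_{ℚ_v}`-morphism **`localTwistHom : T_pA|_{Γ_{ℚ_v}} ⟶ T_pW|_{Γ_{ℚ_v}}`**
  given by `u`, `layerLocOver_layerResTwist` (`loc_{w̄,n} ∘ res^A_n = H¹(u_v)_n ∘ loc_{v,n}`), and on the carriers
  **`IwasawaH1DataOver.locOver_resOverTwist`**: `loc_w̄ (res^A x) = 𝐇¹(u_v) (loc_v x)`, whence
  **`range_map_loc_le_range_locOver`**: `𝐇¹(u_v)(loc_v 𝐇¹_Γ(T_pA)) ≤ loc_w̄ 𝐇¹_{K,Γ}(T_pW_K)` (the `A`-summand of `range_le`).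

References: J. Neukirch, A. Schmidt, K. Wingberg, *Cohomology of Number Fields* (2008), I §5 (1.5.6)–(1.5.7), (1.6.3) [NeukirchSchmidtWingberg2008];
K. Kato, Astérisque 295 (2004) §17.13 (17.13.1) [Kato2004Asterisque]; J. H. Silverman, *AEC* (2009) X.5 Cor. 5.4 [SilvermanAEC2009];
R. Greenberg, LNM 1716 (1999) §4 p. 107 (the twist and `E(K)` vs `E(ℚ) ⊕ E^K(ℚ)` up to `2`) [GreenbergLNM1716].
-/

noncomputable section

open scoped NumberField Pointwise
open CategoryTheory Field IsDedekindDomain Polynomial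
open Literature.NumberTheory.GaloisRepresentations
open Literature.NumberTheory.EllipticCurves (subgroupInclusion subgroupInclusion_apply_coe
  subgroupConj subgroupConj_apply_coe tateModuleEquiv galRange rangeToResGal resGal resGalSubgroupOfEmb_apply_coe)
open Literature.NumberTheory.EllipticCurves.Kato2004.CM (tateRepK integralH1K mem_integralH1K_iff)
open Literature.NumberTheory.EllipticCurves.Kato2004.EulerSystemValues (tateRep)
open Literature.NumberTheory.EllipticCurves.CyclotomicLayer (layerGroup isOpen_layerGroup normal_layerGroup)

namespace Literature.NumberTheory.EllipticCurves.Kato2004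

/-! ## §1 The sum identity `res ∘ cor + res^A ∘ cor^A = 2` -/

section Sum

variable (K : Type) [Field K] [NumberField K] {p : ℕ} [Fact p.Prime] (κ : ZpExtension ℚ p)
  (h : Function.Surjective (κ.toContinuousMonoidHom.comp (absGaloisRestrict ℚ K)))
  (W : WeierstrassCurve ℚ) [W.IsElliptic] [ContinuousSMul ℤ_[p] (W.tateModule p)]
  [ContinuousSMul ℤ_[p] ((W.baseChange K).tateModule p)]
  (A' : WeierstrassCurve ℚ) [A'.IsElliptic] [ContinuousSMul ℤ_[p] (A'.tateModule p)]
  (u : A'.tateModule p ≃ₗ[ℤ_[p]] W.tateModule p) (hu : Continuous u) (hu' : Continuous u.symm)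
  (hu₁ : ∀ σ : absoluteGaloisGroup ℚ, σ ∈ galRange (K := ℚ) K → ∀ x : A'.tateModule p, u (σ • x) = σ • u x)
  (hu₂ : ∀ σ : absoluteGaloisGroup ℚ, σ ∉ galRange (K := ℚ) K → ∀ x : A'.tateModule p, u (σ • x) = -(σ • u x))

include hu₂ in
/-- **`res_n (cor_n z) + res^A_n (cor^A_n z) = 2 z` on `H¹(K_n, T_pW_K)`** for a quadratic-twist pair (`K/ℚ` Galois, `u` equivariant on
`galRange K` and ANTI-equivariant off it).  Through the model `H¹(V_n, ·)`: `res ∘ cor = Σ_{x ∈ U_n/V_n} conj_{s x}` on both sides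
(`layerResOver_layerCorOver`, `resLe_coresLe_eq_sum_conjMap`); `u_* conj^A_{s x} u⁻¹_* = ± conj^W_{s x}` with `+` exactly for the
identity coset (`s x ∈ V_n`, acting trivially by `conjMap_one_apply_of_mem`) — so the sum is `2·id`. [cite: NeukirchSchmidtWingberg2008, I §5 (1.5.6)–(1.5.7)]
[cite: GreenbergLNM1716, §4 p. 107] -/
theorem layerResCor_add_layerResCorTwist [(galRange (K := ℚ) K).Normal] (n : ℕ)
    (z : H1 (tateRepK (W.baseChange K) p) ((κ.restrict K h).layerSubgroup n)) :
    layerResOver κ h W n (layerCorOver K κ h W n z) +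
        layerResTwist K κ h W A' u hu hu₁ n (layerCorTwist K κ h W A' u hu' hu₁ n z) = (2 : ℕ) • z := by
  classical
  haveI := normal_layerGalRange K κ n
  haveI := finite_quotient_layerGalRange K κ n
  letI : Fintype (κ.layerSubgroup n ⧸ (layerGalRange K κ n).subgroupOf (κ.layerSubgroup n)) := Fintype.ofFinite _
  have hs : ∀ x : κ.layerSubgroup n ⧸ (layerGalRange K κ n).subgroupOf (κ.layerSubgroup n),
      ((Quotient.out x : κ.layerSubgroup n) : κ.layerSubgroup n ⧸ (layerGalRange K κ n).subgroupOf (κ.layerSubgroup n)) = x :=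
    fun x ↦ QuotientGroup.out_eq' x
  rw [layerResOver_layerCorOver K κ h W n hs, layerResTwist_apply, layerCorTwist_apply, resLe_coresLe_eq_sum_conjMap _ _ _ hs,
    ← map_add, map_sum, ← Finset.sum_add_distrib]
  set c := layerToGalRange K κ h W n z with hc
  have hterm : ∀ x : κ.layerSubgroup n ⧸ (layerGalRange K κ n).subgroupOf (κ.layerSubgroup n),
      conjMap (tateRep W p).toTopRep (layerGalRange K κ n) ((Quotient.out x : κ.layerSubgroup n) : absoluteGaloisGroup ℚ) 1 c +
        layerTwist K κ W A' u hu hu₁ n (conjMap (tateRep A' p).toTopRep (layerGalRange K κ n)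
          ((Quotient.out x : κ.layerSubgroup n) : absoluteGaloisGroup ℚ) 1 (layerUntwist K κ W A' u hu' hu₁ n c)) =
      if x = 1 then (2 : ℕ) • c else 0 := by
    intro x
    by_cases hx : ((Quotient.out x : κ.layerSubgroup n) : absoluteGaloisGroup ℚ) ∈ galRange (K := ℚ) K
    · have hV : ((Quotient.out x : κ.layerSubgroup n) : absoluteGaloisGroup ℚ) ∈ layerGalRange K κ n := ⟨hx, (Quotient.out x).2⟩
      have hx1 : x = 1 := by
        rw [← hs x, QuotientGroup.eq_one_iff]
        exact Subgroup.mem_subgroupOf.mpr hV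
      rw [if_pos hx1, layerTwist_conjMap K κ W A' u hu hu₁ n hx, layerTwist_layerUntwist,
        conjMap_one_apply_of_mem (tateRep W p).toTopRep (layerGalRange K κ n) ⟨_, hV⟩ c, two_nsmul]
    · have hx1 : x ≠ 1 := by
        intro h1
        apply hx
        have hmem : (Quotient.out x : κ.layerSubgroup n) ∈ (layerGalRange K κ n).subgroupOf (κ.layerSubgroup n) := by
          rw [← QuotientGroup.eq_one_iff, hs x, h1]
        exact (Subgroup.mem_subgroupOf.mp hmem).1
      rw [if_neg hx1, layerTwist_conjMap_of_not_mem K κ W A' u hu hu₁ hu₂ n hx, layerTwist_layerUntwist, add_neg_cancel]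
  simp_rw [hterm]
  rw [Finset.sum_ite_eq' Finset.univ (1 : κ.layerSubgroup n ⧸ (layerGalRange K κ n).subgroupOf (κ.layerSubgroup n)) (fun _ ↦ (2 : ℕ) • c),
    if_pos (Finset.mem_univ _), map_nsmul, hc, layerOfGalRange_layerToGalRange]

end Sum

section SumCarriers

variable {K : Type} [Field K] [NumberField K] {p : ℕ} [Fact p.Prime] {κ : ZpExtension ℚ p}
  {h : Function.Surjective (κ.toContinuousMonoidHom.comp (absGaloisRestrict ℚ K))}
  {W : WeierstrassCurve ℚ} [W.IsElliptic] [ContinuousSMul ℤ_[p] (W.tateModule p)]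
  [ContinuousSMul ℤ_[p] ((W.baseChange K).tateModule p)]
  {A' : WeierstrassCurve ℚ} [A'.IsElliptic] [ContinuousSMul ℤ_[p] (A'.tateModule p)]
  (u : A'.tateModule p ≃ₗ[ℤ_[p]] W.tateModule p) (hu : Continuous u) (hu' : Continuous u.symm)
  (hu₁ : ∀ σ : absoluteGaloisGroup ℚ, σ ∈ galRange (K := ℚ) K → ∀ x : A'.tateModule p, u (σ • x) = σ • u x)
  (hu₂ : ∀ σ : absoluteGaloisGroup ℚ, σ ∉ galRange (K := ℚ) K → ∀ x : A'.tateModule p, u (σ • x) = -(σ • u x))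
  {γ : absoluteGaloisGroup ℚ} {γK : absoluteGaloisGroup K}
  (I : IwasawaH1Data W p κ γ) (I_A : IwasawaH1Data A' p κ γ) (IK : IwasawaH1DataOver (W.baseChange K) p (κ.restrict K h) γK)

namespace IwasawaH1DataOver

include hu₂ in
/-- **`res (cor x) + res^A (cor^A x) = 2 • x` in `𝐇¹_{K,Γ}(T_pW_K)`** (quadratic-twist pair, `K/ℚ` Galois): the `Λ`-module identity behind
`2 · 𝐇¹_{K,Γ} ⊆ res 𝐇¹_Γ(T_pW) + res^A 𝐇¹_Γ(T_pA)` (Greenberg's `2 E(K) ⊆ E(ℚ) + E^K(ℚ)` in Iwasawa cohomology), levelwise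
`layerResCor_add_layerResCorTwist`. [cite: GreenbergLNM1716, §4 p. 107] [cite: NeukirchSchmidtWingberg2008, I §5 (1.5.6)–(1.5.7)] -/
theorem resOver_corOver_add_resOverTwist_corOverTwist [(galRange (K := ℚ) K).Normal] (hγ : κ.IsTopGenerator γ)
    (hγK : (κ.restrict K h).IsTopGenerator γK) (x : IK.H) :
    I.resOver IK hγ hγK (IK.corOver I hγK hγ x) +
        I_A.resOverTwist u hu hu₁ IK hγ hγK (IK.corOverTwist u hu' hu₁ I_A hγK hγ x) = (2 : ℕ) • x := by
  refine IK.proj_eq_iff.mp fun n ↦ ?_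
  rw [map_add, IwasawaH1Data.proj_resOver, proj_corOver, IwasawaH1Data.proj_resOverTwist, proj_corOverTwist, map_nsmul]
  exact layerResCor_add_layerResCorTwist K κ h W A' u hu hu' hu₁ hu₂ n (IK.proj n x)

include hu' hu₂ in
/-- **`2 · 𝐇¹_{K,Γ}(T_pW_K) ≤ range res + range res^A`**. [cite: GreenbergLNM1716, §4 p. 107] -/
theorem two_smul_mem_range_resOver_sup_range_resOverTwist [(galRange (K := ℚ) K).Normal] (hγ : κ.IsTopGenerator γ)
    (hγK : (κ.restrict K h).IsTopGenerator γK) (x : IK.H) :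
    (2 : IwasawaAlgebra p) • x ∈
      LinearMap.range (I.resOver IK hγ hγK) ⊔ LinearMap.range (I_A.resOverTwist u hu hu₁ IK hγ hγK) := by
  have h2 : (2 : IwasawaAlgebra p) • x = (2 : ℕ) • x := by
    rw [← Nat.cast_smul_eq_nsmul (IwasawaAlgebra p) 2 x, Nat.cast_ofNat]
  rw [h2, ← IK.resOver_corOver_add_resOverTwist_corOverTwist u hu hu' hu₁ hu₂ I I_A hγ hγK x]
  exact Submodule.add_mem_sup ⟨_, rfl⟩ ⟨_, rfl⟩

end IwasawaH1DataOver

end SumCarriers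

/-! ## §2 The local side at a split place: `loc_w̄ ∘ res^A = 𝐇¹(u_v) ∘ loc_v` -/

section Loc

variable (K : Type) [Field K] [NumberField K] {p : ℕ} [Fact p.Prime] (κ : ZpExtension ℚ p)
  (h : Function.Surjective (κ.toContinuousMonoidHom.comp (absGaloisRestrict ℚ K)))
  (v : HeightOneSpectrum (𝓞 ℚ))
  (hD : ∀ g : absoluteGaloisGroup (v.adicCompletion ℚ),
    resGalOfEmb (closureEmb (K := ℚ) (v.adicCompletion ℚ)) g ∈ galRange (K := ℚ) K)
  (W : WeierstrassCurve ℚ) [W.IsElliptic] [ContinuousSMul ℤ_[p] (W.tateModule p)]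
  [ContinuousSMul ℤ_[p] ((W.baseChange K).tateModule p)]
  (A' : WeierstrassCurve ℚ) [A'.IsElliptic] [ContinuousSMul ℤ_[p] (A'.tateModule p)]
  (u : A'.tateModule p ≃ₗ[ℤ_[p]] W.tateModule p) (hu : Continuous u) (hu' : Continuous u.symm)
  (hu₁ : ∀ σ : absoluteGaloisGroup ℚ, σ ∈ galRange (K := ℚ) K → ∀ x : A'.tateModule p, u (σ • x) = σ • u x)

omit [ContinuousSMul ℤ_[p] ((W.baseChange K).tateModule p)] in
variable {K} in
/-- **The local untwisting `u_v : T_pA|_{Γ_{ℚ_v}} ⟶ T_pW|_{Γ_{ℚ_v}}`** at a place `v` whose decomposition group lies in `galRange K` (`v` split in `K`):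
`u` is `Γ_{ℚ_v}`-equivariant there. [cite: SilvermanAEC2009, X.5 Cor. 5.4] -/
def localTwistHom : ((tateRep A' p).toLocal v).toTopRep ⟶ ((tateRep W p).toLocal v).toTopRep :=
  TopRep.ofHom ⟨⟨u.toLinearMap, hu⟩, fun g => ContinuousLinearMap.ext fun x => hu₁ _ (hD g) x⟩

omit [ContinuousSMul ℤ_[p] ((W.baseChange K).tateModule p)] in
variable {K} in
/-- The local untwisting is `u` on elements. [cite: SilvermanAEC2009, X.5 Cor. 5.4] -/
@[simp] theorem localTwistHom_hom_apply (x : A'.tateModule p) : (localTwistHom v hD W A' u hu hu₁).hom x = u x := rfl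

/-- **`loc_{w̄,n} ∘ res^A_n = H¹(u_v)_n ∘ loc_{v,n}`** on `H¹(ℚ_n, T_pA)` — on cocycles both are `g ↦ u(φ(res_v g))`
(`res ∘ ψ = res_v`, `θ_∞⁻¹ ∘ θ_∞ = id`). [cite: Kato2004Asterisque, §17.13 (17.13.1) (p. 279)] -/
theorem layerLocOver_layerResTwist (n : ℕ) (y : H1 (tateRep A' p) (κ.layerSubgroup n)) :
    layerLocOver κ h v hD W n (layerResTwist K κ h W A' u hu hu₁ n y) =
      layerMap κ v (localTwistHom v hD W A' u hu hu₁) n (layerLoc (tateRep A' p) κ v n y) := by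
  obtain ⟨φ, rfl⟩ := oneCocycleClass_surjective _ y
  rw [layerResTwist_apply, resLe_oneCocycleClass, layerTwist_oneCocycleClass, layerOfGalRange_oneCocycleClass,
    layerLocOver_oneCocycleClass, layerLoc_oneCocycleClass, layerMap, cohomologyMap_oneCocycleClass]
  refine congrArg _ (Subtype.ext (ContinuousMap.ext fun g => ?_))
  have harg : subgroupInclusion (layerGalRange_le K κ n) (layerResHomToGalRange K κ h n (layerLocHomOver κ h v hD n g)) =
      layerRes κ v n g :=
    Subtype.ext (by rw [subgroupInclusion_apply_coe, layerResHomToGalRange_apply_coe, layerLocHomOver_apply_coe,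
      absGaloisRestrict_localToAbsGal, resGalSubgroupOfEmb_apply_coe])
  rw [contOneCocycles.pullback_apply, contOneCocycles.pullback_apply, pullback_id_resIdHom_apply, contOneCocycles.pullback_apply,
    layerLocRepHomOver_hom_apply, layerOfGalRangeRepHom_hom_apply, LinearEquiv.symm_apply_apply, twistRepHom_hom_apply,
    TopRep.hom_ofHom, pullback_id_resIdHom_apply, subgroupRepHom_hom_apply, localTwistHom_hom_apply, contOneCocycles.pullback_apply,
    harg]
  rfl

end Loc

section LocCarriers

variable {K : Type} [Field K] [NumberField K] {p : ℕ} [Fact p.Prime] {κ : ZpExtension ℚ p}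
  {h : Function.Surjective (κ.toContinuousMonoidHom.comp (absGaloisRestrict ℚ K))}
  {v : HeightOneSpectrum (𝓞 ℚ)}
  {hD : ∀ g : absoluteGaloisGroup (v.adicCompletion ℚ),
    resGalOfEmb (closureEmb (K := ℚ) (v.adicCompletion ℚ)) g ∈ galRange (K := ℚ) K}
  {W : WeierstrassCurve ℚ} [W.IsElliptic] [ContinuousSMul ℤ_[p] (W.tateModule p)]
  [ContinuousSMul ℤ_[p] ((W.baseChange K).tateModule p)]
  {A' : WeierstrassCurve ℚ} [A'.IsElliptic] [ContinuousSMul ℤ_[p] (A'.tateModule p)]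
  (u : A'.tateModule p ≃ₗ[ℤ_[p]] W.tateModule p) (hu : Continuous u) (hu' : Continuous u.symm)
  (hu₁ : ∀ σ : absoluteGaloisGroup ℚ, σ ∈ galRange (K := ℚ) K → ∀ x : A'.tateModule p, u (σ • x) = σ • u x)
  (hu₂ : ∀ σ : absoluteGaloisGroup ℚ, σ ∉ galRange (K := ℚ) K → ∀ x : A'.tateModule p, u (σ • x) = -(σ • u x))
  {γ : absoluteGaloisGroup ℚ} {γK : absoluteGaloisGroup K} {γᵥ : absoluteGaloisGroup (v.adicCompletion ℚ)}
  (I_A : IwasawaH1Data A' p κ γ) (IK : IwasawaH1DataOver (W.baseChange K) p (κ.restrict K h) γK)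
  (J : LocalIwasawaH1Data κ v ((tateRep W p).toLocal v) γᵥ) (J_A : LocalIwasawaH1Data κ v ((tateRep A' p).toLocal v) γᵥ)

namespace IwasawaH1DataOver

/-- **`loc_w̄ ∘ res^A = 𝐇¹(u_v) ∘ loc_v`** on the pinned carriers: the localisation at the split place of the twisted restriction of a class of
`𝐇¹_Γ(T_pA)` is the local untwisting of its localisation at `v` (levelwise `layerLocOver_layerResTwist`). [cite: Kato2004Asterisque, §17.13 (17.13.1) (p. 279)] -/
theorem locOver_resOverTwist [(galRange (K := ℚ) K).Normal]
    (hsurjv : Function.Surjective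
      (κ.toContinuousMonoidHom.comp (resGalOfEmb (closureEmb (K := ℚ) (v.adicCompletion ℚ)))))
    (hγ : κ.IsTopGenerator γ) (hγK : (κ.restrict K h).IsTopGenerator γK)
    (hγᵥ : κ.IsTopGenerator (resGalOfEmb (closureEmb (K := ℚ) (v.adicCompletion ℚ)) γᵥ)) (x : I_A.H) :
    IK.locOver J hD hsurjv hγK hγᵥ (I_A.resOverTwist u hu hu₁ IK hγ hγK x) =
      J_A.map (localTwistHom v hD W A' u hu hu₁) J (I_A.loc J_A hsurjv hγ hγᵥ x) :=
  J.ext_of_proj fun n ↦ by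
    rw [proj_locOver, IwasawaH1Data.proj_resOverTwist, layerLocOver_layerResTwist, LocalIwasawaH1Data.proj_map,
      IwasawaH1Data.proj_loc]

/-- **`𝐇¹(u_v)(loc_v 𝐇¹_Γ(T_pA)) ≤ loc_w̄ 𝐇¹_{K,Γ}(T_pW_K)`**: the `A`-summand of the Shapiro-lattice inclusion `range(loc_W ⊕ u_A loc_A) ≤ L :=
range locOver` (stub 4‴ `range_le`). [cite: Kato2004Asterisque, §17.13 (17.13.1) (p. 279)] -/
theorem range_map_loc_le_range_locOver [(galRange (K := ℚ) K).Normal]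
    (hsurjv : Function.Surjective
      (κ.toContinuousMonoidHom.comp (resGalOfEmb (closureEmb (K := ℚ) (v.adicCompletion ℚ)))))
    (hγ : κ.IsTopGenerator γ) (hγK : (κ.restrict K h).IsTopGenerator γK)
    (hγᵥ : κ.IsTopGenerator (resGalOfEmb (closureEmb (K := ℚ) (v.adicCompletion ℚ)) γᵥ)) :
    LinearMap.range (J_A.map (localTwistHom v hD W A' u hu hu₁) J ∘ₗ I_A.loc J_A hsurjv hγ hγᵥ) ≤
      LinearMap.range (IK.locOver J hD hsurjv hγK hγᵥ) := by
  rintro _ ⟨x, rfl⟩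
  exact ⟨I_A.resOverTwist u hu hu₁ IK hγ hγK x, IK.locOver_resOverTwist u hu hu₁ I_A J J_A hsurjv hγ hγK hγᵥ x⟩

/-- **The Shapiro lattice contains `loc(𝐇¹_Γ(T_pW)) + u_v loc(𝐇¹_Γ(T_pA))`** — clause `range_le` of the crux-19556 datum with
`L := range locOver`: the `W`-summand is `range_loc_le_range_locOver` (`loc_w̄ ∘ res = loc_v`), the `A`-summand `range_map_loc_le_range_locOver`
(`loc_w̄ ∘ res^A = 𝐇¹(u_v) ∘ loc_v`). [cite: Kato2004Asterisque, §17.13 (17.13.1) (p. 279)] [cite: GreenbergLNM1716, §4 p. 107] -/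
theorem range_coprod_loc_le_range_locOver [(galRange (K := ℚ) K).Normal] (I : IwasawaH1Data W p κ γ)
    (hsurjv : Function.Surjective
      (κ.toContinuousMonoidHom.comp (resGalOfEmb (closureEmb (K := ℚ) (v.adicCompletion ℚ)))))
    (hγ : κ.IsTopGenerator γ) (hγK : (κ.restrict K h).IsTopGenerator γK)
    (hγᵥ : κ.IsTopGenerator (resGalOfEmb (closureEmb (K := ℚ) (v.adicCompletion ℚ)) γᵥ)) :
    LinearMap.range ((I.loc J hsurjv hγ hγᵥ).coprod
        (J_A.map (localTwistHom v hD W A' u hu hu₁) J ∘ₗ I_A.loc J_A hsurjv hγ hγᵥ)) ≤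
      LinearMap.range (IK.locOver J hD hsurjv hγK hγᵥ) := by
  rw [LinearMap.range_coprod]
  exact sup_le (IK.range_loc_le_range_locOver J I hD hsurjv hγ hγK hγᵥ)
    (IK.range_map_loc_le_range_locOver u hu hu₁ I_A J J_A hsurjv hγ hγK hγᵥ)

include hu' hu₂ in
/-- **`2 · L ≤ loc(𝐇¹_Γ(T_pW)) + u_v loc(𝐇¹_Γ(T_pA))` for the Shapiro lattice `L := range locOver`** — clause `two_smul_mem` of the crux-19556
datum (quadratic-twist pair, `K/ℚ` Galois, `v` split): `2·loc_w̄ x = loc_w̄(res cor x + res^A cor^A x) = loc_v (cor x) + 𝐇¹(u_v) loc_v (cor^A x)`.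
[cite: GreenbergLNM1716, §4 p. 107] [cite: Kato2004Asterisque, §17.13 (17.13.1) (p. 279)] -/
theorem two_smul_mem_range_coprod_loc_of_mem_range_locOver [(galRange (K := ℚ) K).Normal] (I : IwasawaH1Data W p κ γ)
    (hsurjv : Function.Surjective
      (κ.toContinuousMonoidHom.comp (resGalOfEmb (closureEmb (K := ℚ) (v.adicCompletion ℚ)))))
    (hγ : κ.IsTopGenerator γ) (hγK : (κ.restrict K h).IsTopGenerator γK)
    (hγᵥ : κ.IsTopGenerator (resGalOfEmb (closureEmb (K := ℚ) (v.adicCompletion ℚ)) γᵥ))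
    {y : J.H} (hy : y ∈ LinearMap.range (IK.locOver J hD hsurjv hγK hγᵥ)) :
    (2 : IwasawaAlgebra p) • y ∈ LinearMap.range ((I.loc J hsurjv hγ hγᵥ).coprod
        (J_A.map (localTwistHom v hD W A' u hu hu₁) J ∘ₗ I_A.loc J_A hsurjv hγ hγᵥ)) := by
  obtain ⟨x, rfl⟩ := hy
  have h2 : (2 : IwasawaAlgebra p) • x = (2 : ℕ) • x := by
    rw [← Nat.cast_smul_eq_nsmul (IwasawaAlgebra p) 2 x, Nat.cast_ofNat]
  rw [← map_smul, h2, ← IK.resOver_corOver_add_resOverTwist_corOverTwist u hu hu' hu₁ hu₂ I I_A hγ hγK x, map_add,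
    IK.locOver_resOver J I hD hsurjv hγ hγK hγᵥ, IK.locOver_resOverTwist u hu hu₁ I_A J J_A hsurjv hγ hγK hγᵥ,
    LinearMap.range_coprod]
  exact Submodule.add_mem_sup ⟨_, rfl⟩ ⟨_, rfl⟩

end IwasawaH1DataOver

end LocCarriers

end Literature.NumberTheory.EllipticCurves.Kato2004

end
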